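import Literature.Barriers.CriticalPhenomena.LaceExpansionIsingDeconvolutionPartsEstimates
import Literature.Barriers.CriticalPhenomena.LaceExpansionIsingDeconvolutionConvAlgebra
import Literature.Analysis.FunctionSpaces.TorusRieszFischerParam
import HarnessLib

/-!
# Liu–Slade's Theorem 1.7, assembly part II: Fourier analysis on `ℓ¹(ℤ^d)` and `ℓ²(ℤ^d)`
# (`G_z = 𝒢_z` and `F̂Ĝ = 1`)

Barrier catalogue `Literature/Barriers/CriticalPhenomena/` (D-0021), companion of
`LaceExpansionIsingDeconvolutionParts.lean` (torus-side objects `latticeFourier F t = Σ F(x)e_x(t)`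
on Mathlib's `UnitAddTorus (Fin d)` and `fourierInverseG F x = Re ∫ e_{-x}/F̂`, the Fourier integral
(2.1)). This file PROVES the two unnumbered Fourier steps of the proof of Theorem 1.7
(Liu–Slade 2026, §2.2):

* proof of Prop. 2.3: "Since `G_z` satisfies `F_z * G_z = δ` and both `F_z` and `G_z` are
  summable, we have `F̂_z(k)Ĝ_z(k) = 1` and hence `G_z` is equal to the Fourier integral `𝒢_z`"
  — `eq_fourierInverseG` (with `latticeFourier_latticeConv`, the convolution theorem on `ℓ¹`,
  `mFourierCoeff_latticeFourier`, Fourier inversion on `ℓ¹` by the orthonormality of the characters,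
  and `tsum_mul_tsum_eq_one`: `F̂_z(0)Ĝ_z(0) = 1`, i.e. (2.14));
* proof of Thm. 1.7: "To prove that also `G_{z_c} = 𝒢_{z_c}`, by the `L²` Fourier transform it
  suffices to show that `G_{z_c} ∈ ℓ²(ℤ^d)`" — `exists_memLp_two_latticeFourier_mul_ae_eq_one`
  (Riesz–Fischer through Mathlib's `UnitAddTorus.mFourierBasis`, the coefficients of `F̂·Ĝ`, and
  Parseval: `F̂Ĝ = 1` a.e.), `eq_fourierInverseG_of_summable_sq` (`G = 𝒢`), and the Parseval
  pairing `hasSum_mul_eq_integral_conj_mul` (`Σ_x p(x)G(x) = ∫ conj(p̂) Ĝ`) used by the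
  criticality argument of `LaceExpansionIsingDeconvolutionCriticality.lean`.

All integrals are with respect to the global `volume` of `UnitAddTorus (Fin d)`; Mathlib's `L²`
objects are typed with its Haar volume `Measure.pi (fun _ => AddCircle.haarAddCircle)`, equal to it
(`Torus.volume_eq_pi_haarAddCircle` of `Literature/Analysis/FunctionSpaces/FlatTorus.lean`),
whose `Torus.mFourierCoeff_eq_integral_conj_mul`, `Torus.integral_conj_mFourier_mul_mFourier`,
`Torus.mFourierCoeff_mFourier` are the bridge. The `ℓ¹` convolution algebra itself
(`summable_abs_latticeConv`, `abs_le_tsum_abs`, associativity) is the tree's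
`LaceExpansionIsingDeconvolutionConvAlgebra.lean`.

## References

* Y. Liu, G. Slade, *Gaussian deconvolution and the lace expansion for spread-out models*,
  Ann. Inst. H. Poincaré Probab. Statist. 62 (2026), arXiv:2310.07640: (1.4) (Fourier transform and
  inversion), (2.1), proof of Prop. 2.3 ((2.14), `G_z = 𝒢_z`), proof of Thm. 1.7 (the `L²`
  Fourier transform at `z_c`) [LiuSlade2026].
* L. Grafakos, *Classical Fourier Analysis*, 3rd ed. (2014), Prop. 3.2.7 (orthonormality and
  completeness of the characters on `𝕋^d`; via the tree's `TorusRieszFischerParam.lean`) [Grafakos2014].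
-/

noncomputable section

namespace Literature.Barriers.CriticalPhenomena.SpreadOutIsing

open Filter UnitAddTorus Literature.Probability.LatticeModels
open Literature.Analysis.FunctionSpaces
open _root_.MeasureTheory _root_.Topology
open scoped ComplexConjugate ENNReal NNReal

variable {d : ℕ}

/-! ## Fourier analysis on `ℓ¹(ℤ^d)`: the transform, inversion by orthonormality, convolution -/

section L1

variable {F G : Site d → ℝ}

/-- `|e_x(t)| = 1`, so the terms of `F̂(t)` have norms `|F(x)|`. [folklore] -/
theorem norm_latticeFourier_term (F : Site d → ℝ) (x : Site d) (t : UnitAddTorus (Fin d)) :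
    ‖(F x : ℂ) * mFourier x t‖ = |F x| := by
  rw [norm_mul, Complex.norm_real, Real.norm_eq_abs, Torus.norm_mFourier_apply, mul_one]

/-- The terms of `F̂(t)` are absolutely summable when `F` is. [folklore] -/
theorem summable_norm_latticeFourier_term (hF : Summable fun x => |F x|) (t : UnitAddTorus (Fin d)) :
    Summable fun x : Site d => ‖(F x : ℂ) * mFourier x t‖ := by
  simpa only [norm_latticeFourier_term] using hF

/-- The terms of `F̂(t)` are summable when `F` is absolutely summable. [folklore] -/
theorem summable_latticeFourier_term (hF : Summable fun x => |F x|) (t : UnitAddTorus (Fin d)) :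
    Summable fun x : Site d => (F x : ℂ) * mFourier x t :=
  (summable_norm_latticeFourier_term hF t).of_norm

/-- `F̂` is the sum of its series. [folklore] -/
theorem hasSum_latticeFourier (hF : Summable fun x => |F x|) (t : UnitAddTorus (Fin d)) :
    HasSum (fun x : Site d => (F x : ℂ) * mFourier x t) (latticeFourier F t) :=
  (summable_latticeFourier_term hF t).hasSum

/-- `|F̂(t)| ≤ Σ_x |F(x)|`. [folklore] -/
theorem norm_latticeFourier_le (hF : Summable fun x => |F x|) (t : UnitAddTorus (Fin d)) :
    ‖latticeFourier F t‖ ≤ ∑' x, |F x| := by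
  refine (norm_tsum_le_tsum_norm (summable_norm_latticeFourier_term hF t)).trans_eq ?_
  exact tsum_congr fun x => norm_latticeFourier_term F x t

/-- **`F̂` is continuous** for absolutely summable `F` (uniform convergence of the series).
[folklore] -/
theorem continuous_latticeFourier (hF : Summable fun x => |F x|) : Continuous (latticeFourier F) := by
  refine continuous_tsum (fun x => continuous_const.mul (mFourier x).continuous) hF fun x t => ?_
  exact (norm_latticeFourier_term F x t).le

/-- `δ̂₀ ≡ 1` (torus side). [folklore] -/
theorem latticeFourier_delta0 (t : UnitAddTorus (Fin d)) : latticeFourier (delta0 : Site d → ℝ) t = 1 := by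
  unfold latticeFourier
  rw [tsum_eq_single 0]
  · simp [delta0, mFourier_zero]
  · intro x hx
    rw [delta0_of_ne_zero hx]
    simp

/-- **Fourier inversion on `ℓ¹(ℤ^d)` by orthonormality**: the `x`-th Fourier coefficient of
`Ĝ = Σ_y G(y) e_y` is `G(x)` (`∫ conj(e_x) e_y = δ_{xy}`, with the interchange of sum and integral
justified by `Σ_y |G(y)| < ∞` on a probability space). This is (1.4): "`f(x) = ∫ f̂(k)e^{-ik·x} dk/(2π)^d`".
[cite: LiuSlade2026, (1.4)] -/
theorem mFourierCoeff_latticeFourier (hG : Summable fun x => |G x|) (x : Site d) :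
    mFourierCoeff (latticeFourier G) x = (G x : ℂ) := by
  classical
  rw [Torus.mFourierCoeff_eq_integral_conj_mul]
  -- expand `Ĝ` and interchange
  have hfun : (fun t : UnitAddTorus (Fin d) => conj (mFourier x t) * latticeFourier G t) =
      fun t => ∑' y : Site d, conj (mFourier x t) * ((G y : ℂ) * mFourier y t) := by
    funext t
    rw [← (hasSum_latticeFourier hG t).tsum_eq, tsum_mul_left]
  rw [hfun, integral_tsum]
  · -- orthonormality
    have h : ∀ y : Site d, ∫ t : UnitAddTorus (Fin d), conj (mFourier x t) * ((G y : ℂ) * mFourier y t) =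
        (G y : ℂ) * (if x = y then 1 else 0) := by
      intro y
      rw [← Torus.integral_conj_mFourier_mul_mFourier x y, ← integral_const_mul]
      refine integral_congr_ae (Filter.Eventually.of_forall fun t => ?_)
      simp only; ring
    simp_rw [h]
    rw [tsum_eq_single x]
    · simp
    · intro y hy
      simp [Ne.symm hy]
  · intro y
    exact ((continuous_star.comp (mFourier x).continuous).mul
      (continuous_const.mul (mFourier y).continuous)).aestronglyMeasurable
  · -- `Σ_y ∫ ‖·‖ = Σ_y |G y| < ∞`
    have h : ∀ y : Site d, ∫⁻ t : UnitAddTorus (Fin d), ‖conj (mFourier x t) * ((G y : ℂ) * mFourier y t)‖ₑ =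
        ‖G y‖ₑ := by
      intro y
      have hpt : ∀ t : UnitAddTorus (Fin d), ‖conj (mFourier x t) * ((G y : ℂ) * mFourier y t)‖ₑ = ‖G y‖ₑ := by
        intro t
        rw [← ofReal_norm, ← ofReal_norm, norm_mul, norm_mul, RCLike.norm_conj,
          Torus.norm_mFourier_apply, Torus.norm_mFourier_apply, one_mul, mul_one, Complex.norm_real]
      simp_rw [hpt]
      rw [lintegral_const, measure_univ, mul_one]
    simp_rw [h]
    have hG' : Summable fun y => ‖G y‖₊ := by
      rw [← NNReal.summable_coe]
      simpa only [coe_nnnorm, Real.norm_eq_abs] using hG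
    have := ENNReal.tsum_coe_ne_top_iff_summable.2 hG'
    simpa only [enorm_eq_nnnorm] using this

/-- **Fourier inversion, real form**: `G(x) = Re ∫ e^{-2πi t·x} Ĝ(t) dt` for `G ∈ ℓ¹(ℤ^d)`.
[cite: LiuSlade2026, (1.4)] -/
theorem re_mFourierCoeff_latticeFourier (hG : Summable fun x => |G x|) (x : Site d) :
    (mFourierCoeff (latticeFourier G) x).re = G x := by
  rw [mFourierCoeff_latticeFourier hG, Complex.ofReal_re]

/-- The double family `(x, y) ↦ F(y) G(x - y)` is absolutely summable for `F, G ∈ ℓ¹`. [folklore] -/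
theorem summable_conv_family (hF : Summable fun x => |F x|) (hG : Summable fun x => |G x|) :
    Summable fun p : Site d × Site d => |F p.2 * G (p.1 - p.2)| := by
  -- from the product family `(y, w) ↦ F y G w` along `(y, w) ↦ (y + w, y)`
  have hprod : Summable fun q : Site d × Site d => |F q.1| * |G q.2| :=
    summable_mul_of_summable_norm (f := fun y => |F y|) (g := fun w => |G w|)
      (by simpa only [Real.norm_eq_abs, abs_abs] using hF)
      (by simpa only [Real.norm_eq_abs, abs_abs] using hG)
  set e : Site d × Site d ≃ Site d × Site d :=
    { toFun := fun q => (q.1 + q.2, q.1)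
      invFun := fun p => (p.2, p.1 - p.2)
      left_inv := fun q => by simp
      right_inv := fun p => by simp } with he
  have h2 : Summable fun p : Site d × Site d => |F (e.symm p).1| * |G (e.symm p).2| :=
    (e.symm.summable_iff (f := fun q : Site d × Site d => |F q.1| * |G q.2|)).2 hprod
  refine h2.congr fun p => ?_
  simp only [he, Equiv.coe_fn_symm_mk, abs_mul]

/-- Each fibre `y ↦ F(y) G(x-y)` is summable (`F ∈ ℓ¹`, `G ∈ ℓ¹`). [folklore] -/
theorem summable_conv_fibre (hF : Summable fun x => |F x|) (hG : Summable fun x => |G x|) (x : Site d) :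
    Summable fun y => F y * G (x - y) :=
  (((summable_conv_family hF hG).prod_factor x)).of_abs

/-- The term family of `F̂(t)Ĝ(t)` written over `(x, y)` with `x` the total momentum:
`f_t(x, y) = F(y)e_y(t) · G(x-y)e_{x-y}(t)`. [folklore] -/
theorem summable_convTerm (hF : Summable fun x => |F x|) (hG : Summable fun x => |G x|)
    (t : UnitAddTorus (Fin d)) :
    Summable fun p : Site d × Site d =>
      ((F p.2 : ℂ) * mFourier p.2 t) * ((G (p.1 - p.2) : ℂ) * mFourier (p.1 - p.2) t) := by
  refine Summable.of_norm ?_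
  refine (summable_conv_family hF hG).congr fun p => ?_
  rw [norm_mul, norm_latticeFourier_term, norm_latticeFourier_term, abs_mul]

/-- **Convolution theorem on `ℓ¹(ℤ^d)`**: `(F * G)^(t) = F̂(t) Ĝ(t)`. [folklore] -/
theorem latticeFourier_latticeConv (hF : Summable fun x => |F x|) (hG : Summable fun x => |G x|)
    (t : UnitAddTorus (Fin d)) :
    latticeFourier (latticeConv F G) t = latticeFourier F t * latticeFourier G t := by
  have hFn := summable_norm_latticeFourier_term hF t
  have hGn := summable_norm_latticeFourier_term hG t
  -- the reindexing `(y, w) ↦ (y + w, y)`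
  let e : Site d × Site d ≃ Site d × Site d :=
    (Equiv.prodShear (Equiv.refl _) fun y => Equiv.addLeft y).trans (Equiv.prodComm _ _)
  have he : ∀ q : Site d × Site d, e q = (q.1 + q.2, q.1) := fun q => rfl
  -- the `(x, y)`-family
  let f : Site d × Site d → ℂ := fun p =>
    ((F p.2 : ℂ) * mFourier p.2 t) * ((G (p.1 - p.2) : ℂ) * mFourier (p.1 - p.2) t)
  have hf : ∀ p : Site d × Site d,
      f p = ((F p.2 : ℂ) * mFourier p.2 t) * ((G (p.1 - p.2) : ℂ) * mFourier (p.1 - p.2) t) :=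
    fun p => rfl
  have hfe : ∀ q : Site d × Site d,
      f (e q) = ((F q.1 : ℂ) * mFourier q.1 t) * ((G q.2 : ℂ) * mFourier q.2 t) := by
    intro q
    rw [he, hf]
    simp only [add_sub_cancel_left]
  have hfS : Summable f := summable_convTerm hF hG t
  -- Step 1: product of the series = double series over `(y, w)` = double series over `(x, y)`
  have h1 : latticeFourier F t * latticeFourier G t = ∑' p, f p := by
    rw [← (hasSum_latticeFourier hF t).tsum_eq, ← (hasSum_latticeFourier hG t).tsum_eq,
      tsum_mul_tsum_of_summable_norm hFn hGn, ← e.tsum_eq f]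
    exact tsum_congr fun q => (hfe q).symm
  -- Step 2: fibrewise summation
  have hfib : ∀ x : Site d, Summable fun y => f (x, y) := fun x =>
    hfS.prod_factor x
  have h2 : ∑' p, f p = ∑' (x : Site d) (y : Site d), f (x, y) := hfS.tsum_prod' hfib
  -- Step 3: the inner sums
  have h3 : ∀ x : Site d, ∑' y, f (x, y) = ((latticeConv F G x : ℝ) : ℂ) * mFourier x t := by
    intro x
    have hinner : ∀ y, f (x, y) = ((F y * G (x - y) : ℝ) : ℂ) * mFourier x t := by
      intro y
      rw [hf]
      have hxy : mFourier y t * mFourier (x - y) t = mFourier x t := by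
        rw [← mFourier_add]; congr 1; abel
      rw [← hxy]
      push_cast
      ring
    simp_rw [hinner]
    rw [tsum_mul_right, latticeConv, Complex.ofReal_tsum]
  rw [h1, h2]
  simp_rw [h3]
  rfl

/-- **Sum of a convolution**: `Σ_x (F*G)(x) = (Σ F)(Σ G)` for `F, G ∈ ℓ¹(ℤ^d)` (the convolution
theorem at `t = 0`). [folklore] -/
theorem tsum_latticeConv (hF : Summable fun x => |F x|) (hG : Summable fun x => |G x|) :
    ∑' x, latticeConv F G x = (∑' x, F x) * ∑' x, G x := by
  have h := latticeFourier_latticeConv hF hG 0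
  rw [latticeFourier_zero, latticeFourier_zero, latticeFourier_zero] at h
  exact_mod_cast h

/-- **`G = 𝒢` for `ℓ¹` solutions of the impulse equation**: if `F, G ∈ ℓ¹(ℤ^d)` and `F * G = δ`,
then `F̂(t)Ĝ(t) = 1` for every `t` (so `F̂` does not vanish) and `G` is the Fourier integral
`𝒢(x) = ∫ e^{-ik·x}/F̂(k)` of (2.1) — the step "Since `G_z` satisfies `F_z * G_z = δ` and both `F_z`
and `G_z` are summable, we have `F̂_z(k)Ĝ_z(k) = 1` and hence `G_z` is equal to the Fourier
integral `𝒢_z`" of the proof of Prop. 2.3. [cite: LiuSlade2026, proof of Proposition 2.3] -/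
theorem latticeFourier_mul_eq_one (hF : Summable fun x => |F x|) (hG : Summable fun x => |G x|)
    (h : ∀ x, latticeConv F G x = delta0 x) (t : UnitAddTorus (Fin d)) :
    latticeFourier F t * latticeFourier G t = 1 := by
  rw [← latticeFourier_latticeConv hF hG t, show latticeConv F G = delta0 from funext h,
    latticeFourier_delta0]

/-- Under `F * G = δ` with `F, G ∈ ℓ¹`: `Ĝ = 1/F̂` pointwise. [cite: LiuSlade2026, proof of Proposition 2.3] -/
theorem latticeFourier_eq_inv (hF : Summable fun x => |F x|) (hG : Summable fun x => |G x|)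
    (h : ∀ x, latticeConv F G x = delta0 x) (t : UnitAddTorus (Fin d)) :
    latticeFourier G t = (latticeFourier F t)⁻¹ :=
  (eq_inv_of_mul_eq_one_right (latticeFourier_mul_eq_one hF hG h t)).symm ▸ rfl

/-- **`G_z = 𝒢_z`** for `ℓ¹` solutions of `F * G = δ`. [cite: LiuSlade2026, proof of Proposition 2.3 ("G_z is equal to the Fourier integral 𝒢_z")] -/
theorem eq_fourierInverseG (hF : Summable fun x => |F x|) (hG : Summable fun x => |G x|)
    (h : ∀ x, latticeConv F G x = delta0 x) (x : Site d) : G x = fourierInverseG F x := by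
  rw [fourierInverseG]
  have hfun : (fun t : UnitAddTorus (Fin d) => (latticeFourier F t)⁻¹) = latticeFourier G :=
    funext fun t => (latticeFourier_eq_inv hF hG h t).symm
  rw [hfun, re_mFourierCoeff_latticeFourier hG]

/-- `(Σ F)(Σ G) = 1` for `ℓ¹` solutions of `F * G = δ` — the identity (2.14),
`F̂_z(0) = 1/Ĝ_z(0) = 1/Σ_x G_z(x)`. [cite: LiuSlade2026, (2.14)] -/
theorem tsum_mul_tsum_eq_one (hF : Summable fun x => |F x|) (hG : Summable fun x => |G x|)
    (h : ∀ x, latticeConv F G x = delta0 x) : (∑' x, F x) * ∑' x, G x = 1 := by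
  rw [← tsum_latticeConv hF hG, show latticeConv F G = delta0 from funext h, hasSum_delta0.tsum_eq]

end L1

/-! ## Fourier analysis on `ℓ²(ℤ^d)`: Plancherel (Mathlib's `mFourierBasis`), `F̂Ĝ = 1` a.e. -/

section L2

variable {F G : Site d → ℝ}

/-- Fourier coefficients depend only on the a.e. class (global volume). [folklore] -/
theorem mFourierCoeff_congr_ae {f f' : UnitAddTorus (Fin d) → ℂ} (h : f =ᵐ[volume] f') (n : Site d) :
    mFourierCoeff f n = mFourierCoeff f' n := by
  rw [Torus.mFourierCoeff_eq_integral_conj_mul, Torus.mFourierCoeff_eq_integral_conj_mul]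
  refine integral_congr_ae ?_
  filter_upwards [h] with t ht
  rw [ht]

/-- A square-summable real function on `ℤ^d` is an element of `ℓ²(ℤ^d, ℂ)`. [folklore] -/
theorem memℓp_two_of_summable_sq (hG2 : Summable fun x => G x ^ 2) :
    Memℓp (fun x : Site d => (G x : ℂ)) 2 := by
  rw [memℓp_gen_iff (by norm_num)]
  refine hG2.congr fun x => ?_
  rw [ENNReal.toReal_ofNat, Real.rpow_two, Complex.norm_real, Real.norm_eq_abs, sq_abs]

/-- **Riesz–Fischer on `ℤ^d`** (Mathlib's `UnitAddTorus.mFourierBasis`): a square-summable `G` is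
the sequence of Fourier coefficients of an `L²` function `Ĝ` on `𝕋^d`. [folklore] -/
theorem exists_memLp_two_mFourierCoeff_eq (hG2 : Summable fun x => G x ^ 2) :
    ∃ g : UnitAddTorus (Fin d) → ℂ,
      MemLp g 2 (Measure.pi fun _ : Fin d => AddCircle.haarAddCircle) ∧
        ∀ x : Site d, mFourierCoeff g x = (G x : ℂ) := by
  set Gl : lp (fun _ : Site d => ℂ) 2 := ⟨fun x => (G x : ℂ), memℓp_two_of_summable_sq hG2⟩ with hGl
  set Ĝ : Lp ℂ 2 (Measure.pi fun _ : Fin d => AddCircle.haarAddCircle) :=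
    (mFourierBasis (d := Fin d)).repr.symm Gl with hĜ
  refine ⟨Ĝ, Lp.memLp Ĝ, fun x => ?_⟩
  have h1 : mFourierCoeff (Ĝ : UnitAddTorus (Fin d) → ℂ) x = (mFourierBasis (d := Fin d)).repr Ĝ x :=
    (mFourierBasis_repr Ĝ x).symm
  rw [h1, hĜ, LinearIsometryEquiv.apply_symm_apply]

/-- `conj(e_x) e_y = conj(e_{x-y})`. [folklore] -/
theorem conj_mFourier_mul_mFourier (x y : Site d) (t : UnitAddTorus (Fin d)) :
    conj (mFourier x t) * mFourier y t = conj (mFourier (x - y) t) := by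
  rw [← mFourier_neg, ← mFourier_neg, ← mFourier_add]
  congr 1; abel

/-- **Fourier coefficients of `F̂ · g`** for `F ∈ ℓ¹(ℤ^d)` and `g ∈ L¹(𝕋^d)`:
`𝓕(F̂ g)(x) = Σ_y F(y) 𝓕g(x - y)`. [folklore] -/
theorem mFourierCoeff_latticeFourier_mul (hF : Summable fun x => |F x|)
    {g : UnitAddTorus (Fin d) → ℂ} (hg : Integrable g) (x : Site d) :
    mFourierCoeff (fun t => latticeFourier F t * g t) x =
      ∑' y, (F y : ℂ) * mFourierCoeff g (x - y) := by
  rw [Torus.mFourierCoeff_eq_integral_conj_mul]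
  have hfun : (fun t : UnitAddTorus (Fin d) => conj (mFourier x t) * (latticeFourier F t * g t)) =
      fun t => ∑' y : Site d, (F y : ℂ) * (conj (mFourier (x - y) t) * g t) := by
    funext t
    rw [← (hasSum_latticeFourier hF t).tsum_eq, ← tsum_mul_right, ← tsum_mul_left]
    refine tsum_congr fun y => ?_
    rw [← conj_mFourier_mul_mFourier x y t]; ring
  rw [hfun, integral_tsum]
  · refine tsum_congr fun y => ?_
    rw [integral_const_mul, Torus.mFourierCoeff_eq_integral_conj_mul]
  · intro y
    exact (((continuous_star.comp (mFourier (x - y)).continuous).aestronglyMeasurable.mul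
      hg.aestronglyMeasurable)).const_mul _
  · have h : ∀ y : Site d, ∫⁻ t : UnitAddTorus (Fin d), ‖(F y : ℂ) * (conj (mFourier (x - y) t) * g t)‖ₑ =
        ‖F y‖ₑ * ∫⁻ t, ‖g t‖ₑ := by
      intro y
      rw [← lintegral_const_mul' _ _ enorm_ne_top]
      refine lintegral_congr fun t => ?_
      have hn : ‖(F y : ℂ) * (conj (mFourier (x - y) t) * g t)‖ = |F y| * ‖g t‖ := by
        rw [norm_mul, norm_mul, Complex.norm_real, Real.norm_eq_abs, RCLike.norm_conj,
          Torus.norm_mFourier_apply, one_mul]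
      rw [← ofReal_norm, hn, ENNReal.ofReal_mul (abs_nonneg _), ofReal_norm, Real.enorm_eq_ofReal_abs]
    simp_rw [h]
    rw [ENNReal.tsum_mul_right]
    refine ENNReal.mul_ne_top ?_ hg.2.ne
    have hF' : Summable fun y => ‖F y‖₊ := by
      rw [← NNReal.summable_coe]
      simpa only [coe_nnnorm, Real.norm_eq_abs] using hF
    have := ENNReal.tsum_coe_ne_top_iff_summable.2 hF'
    simpa only [enorm_eq_nnnorm] using this

/-- The Fourier coefficients of the constant `1` are `δ_{0,x}`. [folklore] -/
theorem mFourierCoeff_const_one (x : Site d) :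
    mFourierCoeff (fun _ : UnitAddTorus (Fin d) => (1 : ℂ)) x = (delta0 x : ℂ) := by
  classical
  have h := Torus.mFourierCoeff_mFourier (d := Fin d) x 0
  rw [mFourier_zero] at h
  have hfun : (⇑(1 : C(UnitAddTorus (Fin d), ℂ)) : UnitAddTorus (Fin d) → ℂ) = fun _ => 1 := rfl
  rw [hfun] at h
  rw [h]
  unfold delta0
  split_ifs <;> simp

/-- Fourier coefficients are additive under integrability (global volume). [folklore] -/
theorem mFourierCoeff_sub {f f' : UnitAddTorus (Fin d) → ℂ} (hf : Integrable f) (hf' : Integrable f')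
    (n : Site d) : mFourierCoeff (fun t => f t - f' t) n = mFourierCoeff f n - mFourierCoeff f' n := by
  rw [Torus.mFourierCoeff_eq_integral_conj_mul, Torus.mFourierCoeff_eq_integral_conj_mul,
    Torus.mFourierCoeff_eq_integral_conj_mul, ← integral_sub]
  · refine integral_congr_ae (ae_of_all _ fun t => ?_)
    simp only [mul_sub]
  · exact hf.bdd_mul (c := 1) (continuous_star.comp (mFourier n).continuous).aestronglyMeasurable
      (ae_of_all _ fun t => by rw [RCLike.norm_conj, Torus.norm_mFourier_apply])
  · exact hf'.bdd_mul (c := 1) (continuous_star.comp (mFourier n).continuous).aestronglyMeasurable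
      (ae_of_all _ fun t => by rw [RCLike.norm_conj, Torus.norm_mFourier_apply])

/-- An `L²` function on `𝕋^d` all of whose Fourier coefficients vanish is `0` a.e. (Parseval,
Mathlib `UnitAddTorus.hasSum_sq_mFourierCoeff`). [folklore] -/
theorem ae_eq_zero_of_forall_mFourierCoeff_eq_zero {h : UnitAddTorus (Fin d) → ℂ}
    (hh : MemLp h 2 (volume : Measure (UnitAddTorus (Fin d))))
    (hcoeff : ∀ x : Site d, mFourierCoeff h x = 0) : h =ᵐ[volume] 0 := by
  have hh' : MemLp h 2 (Measure.pi fun _ : Fin d => AddCircle.haarAddCircle) :=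
    Torus.volume_eq_pi_haarAddCircle (d := Fin d) ▸ hh
  set hL : Lp ℂ 2 (Measure.pi fun _ : Fin d => AddCircle.haarAddCircle) := hh'.toLp h with hhL
  have hae : (hL : UnitAddTorus (Fin d) → ℂ) =ᵐ[volume] h := by
    rw [Torus.volume_eq_pi_haarAddCircle]; exact hh'.coeFn_toLp
  have key : HasSum (fun x : Site d => ‖mFourierCoeff hL x‖ ^ 2)
      (∫ t, ‖hL t‖ ^ 2 ∂(Measure.pi fun _ : Fin d => AddCircle.haarAddCircle)) :=
    UnitAddTorus.hasSum_sq_mFourierCoeff hL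
  have hc : ∀ x : Site d, mFourierCoeff (hL : UnitAddTorus (Fin d) → ℂ) x = 0 := fun x => by
    rw [mFourierCoeff_congr_ae hae, hcoeff]
  simp_rw [hc, norm_zero] at key
  rw [zero_pow two_ne_zero] at key
  have hint0 : ∫ t, ‖hL t‖ ^ 2 ∂(Measure.pi fun _ : Fin d => AddCircle.haarAddCircle) = 0 :=
    key.unique hasSum_zero
  have hint0' : ∫ t, ‖hL t‖ ^ 2 ∂(volume : Measure (UnitAddTorus (Fin d))) = 0 := by
    rw [Torus.volume_eq_pi_haarAddCircle]; exact hint0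
  have hint : Integrable (fun t => ‖hL t‖ ^ 2) (volume : Measure (UnitAddTorus (Fin d))) := by
    rw [Torus.volume_eq_pi_haarAddCircle]
    exact (Lp.memLp hL).integrable_norm_pow two_ne_zero
  have hz := (integral_eq_zero_iff_of_nonneg (fun t => sq_nonneg _) hint).1 hint0'
  filter_upwards [hz, hae] with t ht ht'
  rw [← ht']
  simpa using ht

/-- **`F̂ Ĝ = 1` a.e.** for the `ℓ²` solution of the impulse equation: if `F ∈ ℓ¹(ℤ^d)`, `G` is
bounded and square-summable, and `F * G = δ`, then the `L²(𝕋^d)` function `Ĝ` with Fourier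
coefficients `G` (Riesz–Fischer) satisfies `F̂(t)Ĝ(t) = 1` for a.e. `t` — the step "by the `L²`
Fourier transform it suffices to show that `G_{z_c} ∈ ℓ²(ℤ^d)`" of the proof of Theorem 1.7.
[cite: LiuSlade2026, proof of Theorem 1.7 ("by the L² Fourier transform …")] -/
theorem exists_memLp_two_latticeFourier_mul_ae_eq_one (hF : Summable fun x => |F x|)
    (hG2 : Summable fun x => G x ^ 2) (hconv : ∀ x, latticeConv F G x = delta0 x) :
    ∃ g : UnitAddTorus (Fin d) → ℂ,
      MemLp g 2 (Measure.pi fun _ : Fin d => AddCircle.haarAddCircle) ∧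
        (∀ x : Site d, mFourierCoeff g x = (G x : ℂ)) ∧
        ∀ᵐ t ∂(volume : Measure (UnitAddTorus (Fin d))), latticeFourier F t * g t = 1 := by
  obtain ⟨g, hg2, hcoeff⟩ := exists_memLp_two_mFourierCoeff_eq hG2
  refine ⟨g, hg2, hcoeff, ?_⟩
  have hg2v : MemLp g 2 (volume : Measure (UnitAddTorus (Fin d))) := by
    rw [Torus.volume_eq_pi_haarAddCircle]; exact hg2
  have hgi : Integrable g := hg2v.integrable one_le_two
  have hFg : MemLp (fun t => latticeFourier F t * g t) 2 (volume : Measure (UnitAddTorus (Fin d))) := by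
    refine MemLp.of_le_mul (c := ∑' x, |F x|) hg2v
      ((continuous_latticeFourier hF).aestronglyMeasurable.mul hg2v.1) ?_
    exact ae_of_all _ fun t => by
      rw [norm_mul]
      exact mul_le_mul_of_nonneg_right (norm_latticeFourier_le hF t) (norm_nonneg _)
  have hh2 : MemLp (fun t => latticeFourier F t * g t - 1) 2 (volume : Measure (UnitAddTorus (Fin d))) :=
    hFg.sub (memLp_const 1)
  have hcoeff_h : ∀ x, mFourierCoeff (fun t => latticeFourier F t * g t - 1) x = 0 := by
    intro x
    have h1 : mFourierCoeff (fun t => latticeFourier F t * g t) x = (delta0 x : ℂ) := by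
      rw [mFourierCoeff_latticeFourier_mul hF hgi x]
      simp_rw [hcoeff]
      rw [← hconv x, latticeConv, Complex.ofReal_tsum]
      push_cast
      rfl
    rw [mFourierCoeff_sub (hFg.integrable one_le_two) (integrable_const 1), h1,
      mFourierCoeff_const_one, sub_self]
  have hz := ae_eq_zero_of_forall_mFourierCoeff_eq_zero hh2 hcoeff_h
  filter_upwards [hz] with t ht
  exact sub_eq_zero.1 ht

/-- **Parseval pairing**: for `p ∈ ℓ¹(ℤ^d)` with transform `P = p̂` (continuous) and an `L²(𝕋^d)`
function `g` with Fourier coefficients `G`, `Σ_x p(x) G(x) = ∫ conj(P) g` (Mathlib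
`UnitAddTorus.hasSum_prod_mFourierCoeff`). [folklore] -/
theorem hasSum_mul_eq_integral_conj_mul {p : Site d → ℝ} (hp : Summable fun x => |p x|)
    {g : UnitAddTorus (Fin d) → ℂ} (hg : MemLp g 2 (Measure.pi fun _ : Fin d => AddCircle.haarAddCircle))
    (hcoeff : ∀ x : Site d, mFourierCoeff g x = (G x : ℂ)) :
    HasSum (fun x : Site d => (p x : ℂ) * G x) (∫ t, conj (latticeFourier p t) * g t) := by
  set P : C(UnitAddTorus (Fin d), ℂ) := ⟨latticeFourier p, continuous_latticeFourier hp⟩ with hP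
  have key : HasSum (fun x : Site d => conj (mFourierCoeff (P.toLp 2 (Measure.pi fun _ : Fin d =>
      AddCircle.haarAddCircle) ℂ) x) * mFourierCoeff (hg.toLp g) x)
      (∫ t, conj ((P.toLp 2 (Measure.pi fun _ : Fin d => AddCircle.haarAddCircle) ℂ) t) * (hg.toLp g) t
        ∂(Measure.pi fun _ : Fin d => AddCircle.haarAddCircle)) :=
    hasSum_prod_mFourierCoeff _ _
  have h1 : ∀ x : Site d, mFourierCoeff (P.toLp 2 (Measure.pi fun _ : Fin d =>
      AddCircle.haarAddCircle) ℂ) x = (p x : ℂ) := fun x =>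
    (mFourierCoeff_toLp P x).trans (mFourierCoeff_latticeFourier hp x)
  have haeg : (hg.toLp g : UnitAddTorus (Fin d) → ℂ) =ᵐ[volume] g := by
    rw [Torus.volume_eq_pi_haarAddCircle]; exact hg.coeFn_toLp
  have haeP : ((P.toLp 2 (Measure.pi fun _ : Fin d => AddCircle.haarAddCircle) ℂ) :
      UnitAddTorus (Fin d) → ℂ) =ᵐ[volume] latticeFourier p := by
    rw [Torus.volume_eq_pi_haarAddCircle]
    exact P.coeFn_toLp (p := 2) (μ := Measure.pi fun _ : Fin d => AddCircle.haarAddCircle) (𝕜 := ℂ)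
  have h2 : ∀ x : Site d, mFourierCoeff (hg.toLp g : UnitAddTorus (Fin d) → ℂ) x = (G x : ℂ) :=
    fun x => by rw [mFourierCoeff_congr_ae haeg, hcoeff]
  have h3 : ∫ t, conj ((P.toLp 2 (Measure.pi fun _ : Fin d => AddCircle.haarAddCircle) ℂ) t) *
      (hg.toLp g) t ∂(Measure.pi fun _ : Fin d => AddCircle.haarAddCircle) =
      ∫ t, conj (latticeFourier p t) * g t := by
    have hv : (∫ t, conj ((P.toLp 2 (Measure.pi fun _ : Fin d => AddCircle.haarAddCircle) ℂ) t) *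
        (hg.toLp g) t) = ∫ t, conj ((P.toLp 2 (Measure.pi fun _ : Fin d =>
          AddCircle.haarAddCircle) ℂ) t) * (hg.toLp g) t
          ∂(Measure.pi fun _ : Fin d => AddCircle.haarAddCircle) := by
      rw [Torus.volume_eq_pi_haarAddCircle]
    rw [← hv]
    refine integral_congr_ae ?_
    filter_upwards [haeg, haeP] with t ht ht'
    rw [ht, ht']
  simp_rw [h1, h2, Complex.conj_ofReal] at key
  rwa [h3] at key

/-- **`G = 𝒢` for the `ℓ²` solution of the impulse equation**: with `F ∈ ℓ¹`, `G ∈ ℓ²`,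
`F * G = δ`, `G(x) = Re ∫ e^{-2πi t·x}/F̂(t) dt = fourierInverseG F x` ("To prove that also
`G_{z_c} = 𝒢_{z_c}`, by the `L²` Fourier transform it suffices to show that `G_{z_c} ∈ ℓ²(ℤ^d)`").
[cite: LiuSlade2026, proof of Theorem 1.7] -/
theorem eq_fourierInverseG_of_summable_sq (hF : Summable fun x => |F x|)
    (hG2 : Summable fun x => G x ^ 2) (hconv : ∀ x, latticeConv F G x = delta0 x) (x : Site d) :
    G x = fourierInverseG F x := by
  obtain ⟨g, hg2, hcoeff, hae⟩ := exists_memLp_two_latticeFourier_mul_ae_eq_one hF hG2 hconv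
  rw [fourierInverseG]
  have hinv : (fun t : UnitAddTorus (Fin d) => (latticeFourier F t)⁻¹) =ᵐ[volume] g := by
    filter_upwards [hae] with t ht
    exact (eq_inv_of_mul_eq_one_right ht).symm
  rw [mFourierCoeff_congr_ae hinv, hcoeff, Complex.ofReal_re]

end L2

end Literature.Barriers.CriticalPhenomena.SpreadOutIsing

end
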